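/-
Copyright (c) 2026 the pub-hodgecm-mathlib formalisation cell (harness21).  Prover seat hodgecm-mathlib-F0P2-p02 (g12), 2026-09-01.  «S3-ram» seeding wave (LEAD F0P3a-plan (g12)
T11-41∕T11-44 «B-shift-generic GO»; desk F0P3a-p06 (g15), row «B-shift»): the place-free Cayley-shift level lemmas in the `|c|^n` currency.
-/
import Literature.NumberTheory.Automorphic.MatrixMoebiusShiftLevel   -- ★ p846642 (this lineage, g11): the `|c| = exp(−1)` heads; brings ★ γ₁ `TypeTwoMoebiusShiftValued`, ★ α `MatrixMoebiusShift`
import HarnessLib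

/-!
# The Cayley shift near the identity for ANY shift parameter `0 < |c| < 1`: a level-`(j+1)` element shifts to a level-`j` element, levels counted in powers of `c`
# (Kottwitz 1986 §3; Rogawski 1990 §4.9) — the place-generic twin of ★ `MatrixMoebiusShiftLevel`

Topic `NumberTheory/Automorphic`; namespace `Literature.NumberTheory.Automorphic.MoebiusShift` (valued-field lemmas).  THEOREMS ONLY (no definition, no instance, no notation, no named
fact, no `sorry`); kernel lane `--supports stmt-HodgeConjecture-24833`.  Cell `pub/hodgecm-mathlib` (D-0151), crux H413; «S3-ram» seeding wave (LEAD F0P3a-plan (g12) T11-41,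
T11-44 «p02: B-shift-generic GO»; owner∕desk F0P3a-p06 (g15), `F0/P3a/F0P3a-p06/g15/S3RAM-ORGANS.md` row «B-shift»).  HONEST LABEL: HC_CM is proved only modulo the 2 remaining
named inputs (hLiu418 24832, h413 24833) until rung 0 closes; nothing printed is asserted here.

WHY.  ★ p846642 `valued_det_and_inv_two_c_add` ∕ `valued_moebius_sub_one_le_of_level` ∕ `valued_moebius_scalar_sub_one_le_of_level` bind `hc : |c| = exp(−1)` — at an INERT
place `w ∣ v` the `σ`-fixed uniformiser `ϖ_v` has `|ϖ_v|_w = exp(−1)`.  At a (tame-)RAMIFIED non-split `w ∣ v` (`e(w|v) = 2`) no `σ`-fixed element of `w`-valuation `exp(−1)`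
exists; the `σ`-fixed choice is `c := ϖ_v` with `|c|_w = exp(−2)`, and «level `j` in powers of `c`» is `w`-level `2j`: the shift then drops ONE `v`-level = TWO `w`-levels.  The
proofs of ★ p846642 use `|c| = exp(−1)` only to trade `exp(−n)` for `|c|^n`; here every statement and proof is written in the `|c|^n` currency under `0 < |c| < 1`, `|2| = 1`.

THE MATHEMATICS.  `K` a valued field (value group `ℤᵐ⁰`), `c ∈ K` with `0 < |c| < 1`, `|2| = 1`, `φ_c(g) = ((c+1)g + (c−1))((c−1)g + (c+1))⁻¹`.  §1: `|c ± 1| = 1`.  §2: for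
`M = 2c·1 + t·E` (`2 × 2`, `|t| ≤ 1`, `|E_{ab}| ≤ |c|^{j+1}`, `j ≥ 1`): `|det M| = |c|²` and `|(M⁻¹)_{ab}| ≤ |c|⁻¹` (adjugate).  §3: `g ≡ 1 (mod c^{j+1})` entrywise ⇒
`φ_c(g) ≡ 1` and `φ_c(g)⁻¹ ≡ 1 (mod c^j)` (`φ_c(g) − 1 = 2E·D⁻¹`, `φ_c(g)⁻¹ − 1 = −2E·N⁻¹`, `D = 2c + (c−1)E`, `N = 2c + (c+1)E`); scalar twin for `u ≡ 1 (mod c^{j+1})`, and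
the scalar denominators have `|(c∓1)u + (c±1)| = |c|`.

## References
* [Kottwitz1986] R. E. Kottwitz, *Base change for unit elements of Hecke algebras*, Compositio Math. 60 (1986), §3.
* [Rogawski1990] J. D. Rogawski, *Automorphic Representations of Unitary Groups in Three Variables*, Ann. of Math. Stud. 123 (1990), §4.9 Prop. 4.9.1 (a)(b) p. 55.
* [SerreLocalFields1979] J.-P. Serre, *Local Fields*, GTM 67 (1979), Ch. I §§1–2; Ch. IV §1 (ramification).
-/

set_option autoImplicit false

noncomputable section

open Matrix Polynomial
open scoped WithZero

namespace Literature.NumberTheory.Automorphic.MoebiusShift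

section Generic

variable {K : Type*} [Field K] [Valued K ℤᵐ⁰]

/-! ## §1 The shift parameter: `|c ± 1| = 1` for any `|c| < 1` -/

/-- **`|c| < 1` ⇒ `c ± 1` are units of valuation `1`** (and `c − 1 + 1`, `c + 1 − 1` are small): the generic twin of ★ `shift_parameter_facts`.
[cite: SerreLocalFields1979, Ch. I §§1–2] -/
theorem shift_parameter_facts_of_valued_lt_one {c : K} (hc0 : c ≠ 0) (hc1 : Valued.v c < 1) :
    c ≠ 0 ∧ Valued.v c < 1 ∧ Valued.v (c - 1) = 1 ∧ Valued.v (c + 1) = 1 ∧ Valued.v (c - 1 + 1) < 1 ∧ Valued.v (c + 1 - 1) < 1 := by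
  have h1 : Valued.v c < Valued.v (1 : K) := by rwa [map_one]
  have hn1 : Valued.v c < Valued.v (-1 : K) := by rwa [Valuation.map_neg, map_one]
  refine ⟨hc0, hc1, ?_, ?_, by rwa [sub_add_cancel], by rwa [add_sub_cancel_right]⟩
  · rw [sub_eq_add_neg, Valuation.map_add_eq_of_lt_right _ hn1, Valuation.map_neg, map_one]
  · rw [Valuation.map_add_eq_of_lt_right _ h1, map_one]

/-! ## §2 The denominator near `1`: `|det(2c·1 + t·E)| = |c|²`, `|(…)⁻¹_{ab}| ≤ |c|⁻¹` -/

/-- **The denominator near `1`, generic shift parameter**: for `M = 2c·1 + t·E` (`2 × 2`, `|t| ≤ 1`, `|E_{ab}| ≤ |c|^{j+1}`, `j ≥ 1`, `0 < |c| < 1`, `|2| = 1`):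
`|det M| = |c|²` and `|(M⁻¹)_{ab}| ≤ |c|⁻¹` (adjugate formula; the twin of ★ `valued_det_and_inv_two_c_add` with `exp(−1) ↦ |c|`).
[cite: Kottwitz1986, §3] [cite: SerreLocalFields1979, Ch. I §§1–2] -/
theorem valued_det_and_inv_two_c_add_of_valued_lt_one (h2 : Valued.v (2 : K) = 1) {c : K} (hc0 : c ≠ 0) (hc1 : Valued.v c < 1)
    {t : K} (ht : Valued.v t ≤ 1) {E : Matrix (Fin 2) (Fin 2) K} {j : ℕ} (hj : 1 ≤ j) (hE : ∀ a b, Valued.v (E a b) ≤ Valued.v c ^ (j + 1)) :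
    Valued.v (((2 * c) • (1 : Matrix (Fin 2) (Fin 2) K) + t • E).det) = Valued.v c ^ 2 ∧
      ∀ a b, Valued.v ((((2 * c) • (1 : Matrix (Fin 2) (Fin 2) K) + t • E)⁻¹) a b) ≤ (Valued.v c)⁻¹ := by
  set M : Matrix (Fin 2) (Fin 2) K := (2 * c) • (1 : Matrix (Fin 2) (Fin 2) K) + t • E with hM
  have hvc0 : Valued.v c ≠ 0 := (Valuation.ne_zero_iff _).2 hc0
  have hvcpos : 0 < Valued.v c := zero_lt_iff.2 hvc0
  have h2c : Valued.v (2 * c) = Valued.v c := by rw [map_mul, h2, one_mul]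
  -- `|c|^{j+1} < |c|` since `j ≥ 1` and `|c| < 1`
  have hpow_lt : Valued.v c ^ (j + 1) < Valued.v c := pow_lt_self_of_lt_one₀ hvcpos hc1 (by omega)
  have hsmall : ∀ a b, Valued.v (t * E a b) < Valued.v c := fun a b => by
    rw [map_mul]
    calc Valued.v t * Valued.v (E a b) ≤ 1 * Valued.v c ^ (j + 1) := mul_le_mul' ht (hE a b)
      _ = Valued.v c ^ (j + 1) := one_mul _
      _ < Valued.v c := hpow_lt
  have hdiag : ∀ a, Valued.v (M a a) = Valued.v c := fun a => by
    have e : M a a = 2 * c + t * E a a := by simp [hM, Matrix.add_apply, Matrix.smul_apply, Matrix.one_apply_eq]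
    rw [e, Valuation.map_add_eq_of_lt_left _ (by rw [h2c]; exact hsmall a a), h2c]
  have hoff : ∀ a b, a ≠ b → Valued.v (M a b) < Valued.v c := fun a b hab => by
    have e : M a b = t * E a b := by simp [hM, Matrix.add_apply, Matrix.smul_apply, Matrix.one_apply_ne hab]
    rw [e]; exact hsmall a b
  have hall : ∀ a b, Valued.v (M a b) ≤ Valued.v c := fun a b => by
    by_cases hab : a = b
    · subst hab; exact (hdiag a).le
    · exact (hoff a b hab).le
  -- the determinant
  have hdet : Valued.v M.det = Valued.v c ^ 2 := by
    rw [Matrix.det_fin_two]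
    have hmain : Valued.v (M 0 0 * M 1 1) = Valued.v c ^ 2 := by
      rw [map_mul, hdiag, hdiag, pow_two]
    have hsub : Valued.v (M 0 1 * M 1 0) < Valued.v (M 0 0 * M 1 1) := by
      rw [hmain, map_mul, mul_comm, pow_two]
      exact mul_lt_mul_of_le_of_lt_of_nonneg_of_pos (hall 1 0) (hoff 0 1 (by decide)) zero_le hvcpos
    rw [Valuation.map_sub_eq_of_lt_left _ hsub, hmain]
  refine ⟨hdet, fun a b => ?_⟩
  have hadj : ∀ a b, Valued.v (M.adjugate a b) ≤ Valued.v c := fun a b => by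
    rw [Matrix.adjugate_fin_two]
    fin_cases a <;> fin_cases b
    · simpa using hall 1 1
    · simpa using hall 0 1
    · simpa using hall 1 0
    · simpa using hall 0 0
  rw [Matrix.inv_def, Matrix.smul_apply, smul_eq_mul, Ring.inverse_eq_inv', map_mul, map_inv₀, hdet]
  calc (Valued.v c ^ 2)⁻¹ * Valued.v (M.adjugate a b) ≤ (Valued.v c ^ 2)⁻¹ * Valued.v c := mul_le_mul' le_rfl (hadj a b)
    _ = (Valued.v c)⁻¹ := by rw [pow_two, mul_inv, mul_assoc, inv_mul_cancel₀ hvc0, mul_one]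

/-! ## §3 A level-`(j+1)` element shifts to a level-`j` element, levels in powers of `c` -/

/-- **A LEVEL-`(j+1)` ELEMENT SHIFTS TO A LEVEL-`j` ELEMENT, generic shift parameter** (`2 × 2`; `0 < |c| < 1`, `|2| = 1`): `g ≡ 1 (mod c^{j+1})` entrywise, `j ≥ 1` ⇒
`φ_c(g) − 1 ≡ 0` and `φ_c(g)⁻¹ − 1 ≡ 0 (mod c^j)` entrywise (`φ_c(g) − 1 = 2(g−1)·D⁻¹`, `φ_c(g)⁻¹ − 1 = −2(g−1)·N⁻¹`; the twin of ★ `valued_moebius_sub_one_le_of_level`).  At a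
tame-ramified non-split `w ∣ v` with `c = ϖ_v` (`|c|_w = exp(−2)`) this is the drop `w`-level `2j + 2 ↦ 2j`. [cite: Kottwitz1986, §3] [cite: Rogawski1990, §4.9 Prop. 4.9.1 (b) p. 55] -/
theorem valued_moebius_sub_one_le_of_level_of_valued_lt_one (h2 : Valued.v (2 : K) = 1) {c : K} (hc0 : c ≠ 0) (hc1 : Valued.v c < 1)
    (g : Matrix (Fin 2) (Fin 2) K) {j : ℕ} (hj : 1 ≤ j) (hg : ∀ a b, Valued.v ((g - 1) a b) ≤ Valued.v c ^ (j + 1)) :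
    (∀ a b, Valued.v ((((c + 1) • g + (c - 1) • (1 : Matrix (Fin 2) (Fin 2) K)) * ((c - 1) • g + (c + 1) • (1 : Matrix (Fin 2) (Fin 2) K))⁻¹ - 1) a b) ≤
        Valued.v c ^ j) ∧
      ∀ a b, Valued.v (((((c + 1) • g + (c - 1) • (1 : Matrix (Fin 2) (Fin 2) K)) * ((c - 1) • g + (c + 1) • (1 : Matrix (Fin 2) (Fin 2) K))⁻¹)⁻¹ - 1) a b) ≤
        Valued.v c ^ j := by
  obtain ⟨-, -, hcm, hcp, -, -⟩ := shift_parameter_facts_of_valued_lt_one hc0 hc1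
  have hvc0 : Valued.v c ≠ 0 := (Valuation.ne_zero_iff _).2 hc0
  set E : Matrix (Fin 2) (Fin 2) K := g - 1 with hE
  have hgE : g = 1 + E := by rw [hE, add_sub_cancel]
  -- the two denominators in the `2c·1 + t·E` form
  have hD : (c - 1) • g + (c + 1) • (1 : Matrix (Fin 2) (Fin 2) K) = (2 * c) • (1 : Matrix (Fin 2) (Fin 2) K) + (c - 1) • E := by rw [hgE]; module
  have hN : (c + 1) • g + (c - 1) • (1 : Matrix (Fin 2) (Fin 2) K) = (2 * c) • (1 : Matrix (Fin 2) (Fin 2) K) + (c + 1) • E := by rw [hgE]; module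
  obtain ⟨hdetD, hinvD⟩ := valued_det_and_inv_two_c_add_of_valued_lt_one h2 hc0 hc1 hcm.le hj hg
  obtain ⟨hdetN, hinvN⟩ := valued_det_and_inv_two_c_add_of_valued_lt_one h2 hc0 hc1 hcp.le hj hg
  rw [hD, hN]
  set D : Matrix (Fin 2) (Fin 2) K := (2 * c) • (1 : Matrix (Fin 2) (Fin 2) K) + (c - 1) • E with hDdef
  set N : Matrix (Fin 2) (Fin 2) K := (2 * c) • (1 : Matrix (Fin 2) (Fin 2) K) + (c + 1) • E with hNdef
  have hpow0 : Valued.v c ^ 2 ≠ 0 := pow_ne_zero _ hvc0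
  have hDu : IsUnit D.det := isUnit_iff_ne_zero.2 fun h => by rw [h, map_zero] at hdetD; exact hpow0 hdetD.symm
  have hNu : IsUnit N.det := isUnit_iff_ne_zero.2 fun h => by rw [h, map_zero] at hdetN; exact hpow0 hdetN.symm
  have hNsubD : N - D = (2 : K) • E := by rw [hNdef, hDdef]; module
  -- entry bound for `(2•E) * M⁻¹`
  have hbound : ∀ {Mi : Matrix (Fin 2) (Fin 2) K}, (∀ a b, Valued.v (Mi a b) ≤ (Valued.v c)⁻¹) →
      ∀ a b, Valued.v ((((2 : K) • E) * Mi) a b) ≤ Valued.v c ^ j := by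
    intro Mi hMi a b
    rw [Matrix.mul_apply]
    refine Valuation.map_sum_le _ fun k _ => ?_
    rw [Matrix.smul_apply, smul_eq_mul, map_mul, map_mul, h2, one_mul]
    calc Valued.v (E a k) * Valued.v (Mi k b) ≤ Valued.v c ^ (j + 1) * (Valued.v c)⁻¹ := mul_le_mul' (hg a k) (hMi k b)
      _ = Valued.v c ^ j := by rw [pow_succ, mul_assoc, mul_inv_cancel₀ hvc0, mul_one]
  refine ⟨fun a b => ?_, fun a b => ?_⟩
  · -- `φ(g) − 1 = (N − D) D⁻¹`
    have e : N * D⁻¹ - 1 = ((2 : K) • E) * D⁻¹ := by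
      rw [← hNsubD, sub_mul, Matrix.mul_nonsing_inv D hDu]
    rw [e]
    exact hbound hinvD a b
  · -- `φ(g)⁻¹ − 1 = (D − N) N⁻¹`
    have e : (N * D⁻¹)⁻¹ - 1 = -(((2 : K) • E) * N⁻¹) := by
      rw [Matrix.mul_inv_rev, Matrix.nonsing_inv_nonsing_inv D hDu, ← hNsubD, ← neg_mul, neg_sub, sub_mul, Matrix.mul_nonsing_inv N hNu]
    rw [e, Matrix.neg_apply, Valuation.map_neg]
    exact hbound hinvN a b

/-- **The scalar denominators, generic shift parameter**: `u ≡ 1 (mod c^{j+1})`, `j ≥ 1`, `0 < |c| < 1`, `|2| = 1` ⇒ `|(c−1)u + (c+1)| = |c|` and `|(c+1)u + (c−1)| = |c|`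
(in particular both are non-zero). [cite: Kottwitz1986, §3] [cite: SerreLocalFields1979, Ch. I §§1–2] -/
theorem valued_scalar_shift_denominators_of_valued_lt_one (h2 : Valued.v (2 : K) = 1) {c : K} (hc0 : c ≠ 0) (hc1 : Valued.v c < 1)
    (u : K) {j : ℕ} (hj : 1 ≤ j) (hu : Valued.v (u - 1) ≤ Valued.v c ^ (j + 1)) :
    Valued.v ((c - 1) * u + (c + 1)) = Valued.v c ∧ Valued.v ((c + 1) * u + (c - 1)) = Valued.v c := by
  obtain ⟨-, -, hcm, hcp, -, -⟩ := shift_parameter_facts_of_valued_lt_one hc0 hc1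
  have hvcpos : 0 < Valued.v c := zero_lt_iff.2 ((Valuation.ne_zero_iff _).2 hc0)
  have h2c : Valued.v (2 * c) = Valued.v c := by rw [map_mul, h2, one_mul]
  have hpow_lt : Valued.v c ^ (j + 1) < Valued.v c := pow_lt_self_of_lt_one₀ hvcpos hc1 (by omega)
  have hsmall : ∀ {t : K}, Valued.v t = 1 → Valued.v (t * (u - 1)) < Valued.v (2 * c) := fun {t} ht => by
    rw [map_mul, ht, one_mul, h2c]
    exact hu.trans_lt hpow_lt
  have eD : (c - 1) * u + (c + 1) = 2 * c + (c - 1) * (u - 1) := by ring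
  have eN : (c + 1) * u + (c - 1) = 2 * c + (c + 1) * (u - 1) := by ring
  refine ⟨?_, ?_⟩
  · rw [eD, Valuation.map_add_eq_of_lt_left _ (hsmall hcm), h2c]
  · rw [eN, Valuation.map_add_eq_of_lt_left _ (hsmall hcp), h2c]

/-- **The scalar twin, generic shift parameter**: `u ≡ 1 (mod c^{j+1})`, `j ≥ 1`, `0 < |c| < 1`, `|2| = 1` ⇒ `φ_c(u) − 1 ≡ 0` and `φ_c(u)⁻¹ − 1 ≡ 0 (mod c^j)`,
`φ_c(u) = ((c+1)u + (c−1))∕((c−1)u + (c+1))` (the twin of ★ `valued_moebius_scalar_sub_one_le_of_level`). [cite: Kottwitz1986, §3] -/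
theorem valued_moebius_scalar_sub_one_le_of_level_of_valued_lt_one (h2 : Valued.v (2 : K) = 1) {c : K} (hc0 : c ≠ 0) (hc1 : Valued.v c < 1)
    (u : K) {j : ℕ} (hj : 1 ≤ j) (hu : Valued.v (u - 1) ≤ Valued.v c ^ (j + 1)) :
    Valued.v (((c + 1) * u + (c - 1)) / ((c - 1) * u + (c + 1)) - 1) ≤ Valued.v c ^ j ∧
      Valued.v ((((c + 1) * u + (c - 1)) / ((c - 1) * u + (c + 1)))⁻¹ - 1) ≤ Valued.v c ^ j := by
  have hvc0 : Valued.v c ≠ 0 := (Valuation.ne_zero_iff _).2 hc0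
  obtain ⟨hD, hN⟩ := valued_scalar_shift_denominators_of_valued_lt_one h2 hc0 hc1 u hj hu
  have hD0 : (c - 1) * u + (c + 1) ≠ 0 := fun h => by rw [h, map_zero] at hD; exact hvc0 hD.symm
  have hN0 : (c + 1) * u + (c - 1) ≠ 0 := fun h => by rw [h, map_zero] at hN; exact hvc0 hN.symm
  have hfin : ∀ {d : K}, Valued.v d = Valued.v c → Valued.v (2 * (u - 1) / d) ≤ Valued.v c ^ j := fun {d} hd => by
    rw [map_div₀, map_mul, h2, one_mul, hd, div_eq_mul_inv]
    calc Valued.v (u - 1) * (Valued.v c)⁻¹ ≤ Valued.v c ^ (j + 1) * (Valued.v c)⁻¹ := mul_le_mul' hu le_rfl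
      _ = Valued.v c ^ j := by rw [pow_succ, mul_assoc, mul_inv_cancel₀ hvc0, mul_one]
  refine ⟨?_, ?_⟩
  · have e : ((c + 1) * u + (c - 1)) / ((c - 1) * u + (c + 1)) - 1 = 2 * (u - 1) / ((c - 1) * u + (c + 1)) := by
      rw [div_sub_one hD0]; congr 1; ring
    rw [e]; exact hfin hD
  · have e : (((c + 1) * u + (c - 1)) / ((c - 1) * u + (c + 1)))⁻¹ - 1 = -(2 * (u - 1) / ((c + 1) * u + (c - 1))) := by
      rw [inv_div, div_sub_one hN0, ← neg_div]; congr 1; ring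
    rw [e, Valuation.map_neg]; exact hfin hN

end Generic

end Literature.NumberTheory.Automorphic.MoebiusShift

end
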